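import Literature.IUT.LogThetaLattice.DHodgeTheaterSignSynchronization
import Literature.IUT.HodgeTheaters.PMBaseKitModel

/-!
# Non-vacuity witness for `±`-synchronization / non-surjectivity of `†ℋ𝒯^{𝒟-Θ±ell} ↦ †𝔇_≻` ([IUTchI] Def 6.1, 6.4; [IUTchIII] Prop 1.3 (i))

Mochizuki, *Inter-universal Teichmüller Theory I*, kurims manuscript (May 2020), §6, Def 6.1 (ii)–(vii) pp.156–159, Def 6.4 (iii)
p.163; *III*, kurims (May 2020), Prop 1.3 (i) p.42, Rmk 1.3.1 p.43. PROOF-ONLY companion (theorems, no definitions) by the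
L6 cone prover abc-iut-w4-d017 to `DHodgeTheaterSignSynchronization.lean` (this seat, p417155), over abc-iut-L5-t4's model kit
`PMBaseKit.toyKit` (`PMBaseKitModel.lean`). DAG nodes IUTchIII:Prop1.3(i) / IUTchIII:Thm1.5(i).
([IUTchI] Def 6.4 (iii) p.163) [claim: Mochizuki2012, status: disputed].

PURPOSE (reviewer note on p418230, item 4): every `PMBaseKit` model constructed in the tree so far has ONE valuation
(`toyKit`: `V := Unit`), so the hypothesis `v ≠ w` of p417155's `DHTRep.DRepIso.cod_not_surjective` /
`DHTRep.codFunctor_mapIso_not_surjective` was not instantiable at any tree model. This file instantiates it: pulling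
abc-iut-L5-t4's one-place model kit back along `Bool → Unit` (every per-valuation field of the interface is pulled back
verbatim, the global fields are unchanged) gives a GENUINE two-place model of [IUTchI] Def 6.1 (ii)–(vii) — built INSIDE the
proofs, no new definition — over which the model `𝒟-Θ^{±ell}`-Hodge theater of Examples 6.2 (i)/6.3 (i) (`Ex62.ht`) exists, and
`Isom(†ℋ𝒯, †ℋ𝒯) → Isom(†𝔇_≻, †𝔇_≻)` is NOT surjective, UNCONDITIONALLY (for every prime `l ≠ 2`):
* `DHTRep.DRepIso.exists_kit_cod_not_surjective`, `DHTRep.exists_kit_codFunctor_mapIso_not_surjective`.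
So the negative statements of p417155 are non-vacuous in the tree (their hypothesis set has a model).
HONEST FRAMING: a consistency/non-vacuity witness over a toy model of the typed interface; nothing here bears on
[IUTchIII] Cor 3.12; typed ≠ proved for the series' claims; no side taken.
-/

namespace Literature.IUT.LogThetaLattice

open CategoryTheory
open Literature.IUT.HodgeTheaters Literature.IUT.HodgeTheaters.PMBaseKit

namespace DHTRep

/-- **IUTchI:Def6.1(ii)** (kurims p.156) A TWO-PLACE MODEL of the base interface of [IUTchI] Def 6.1 (ii)–(vii), and over it the
non-surjectivity of `Isom(†ℋ𝒯, †ℋ𝒯) → Isom(†𝔇_≻, †𝔇_≻)` for the model `𝒟-Θ^{±ell}`-Hodge theater — a NON-VACUITY witness for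
p417155's `DRepIso.cod_not_surjective` (hypothesis `v ≠ w`): pull abc-iut-L5-t4's `PMBaseKit.toyKit l hl` (`𝕍 = Unit`) back along
`Bool → Unit` (all per-valuation fields verbatim, global fields unchanged; constructed inside the proof, no new definition),
take `v := false ≠ true =: w`. ([IUTchI] Def 6.1 (ii) p.156) [claim: Mochizuki2012, status: disputed] -/
theorem DRepIso.exists_kit_cod_not_surjective (l : ℕ) [Fact l.Prime] (hl : l ≠ 2) :
    ∃ (K : PMBaseKit.{0} l) (v w : K.V) (_ : v ≠ w) (H : K.DThetaPMEllHT),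
      ¬ Function.Surjective (fun f : DRepIso H H => f.cod) := by
  haveI : NeZero l := ⟨(Fact.out : l.Prime).ne_zero⟩
  let K₁ := PMBaseKit.toyKit l hl
  let K : PMBaseKit.{0} l :=
    { V := Bool
      bad := ∅
      arc := ∅
      Amb := fun _ => K₁.Amb ()
      model := fun _ => K₁.model ()
      pmObj := fun _ => K₁.pmObj ()
      toPM := fun _ => K₁.toPM ()
      LabCuspPM := fun _ => K₁.LabCuspPM ()
      labPM := fun _ => K₁.labPM ()
      labMap := fun _ => K₁.labMap ()
      labMap_refl := fun _ => K₁.labMap_refl ()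
      labMap_trans := fun _ => K₁.labMap_trans ()
      labMap_charts := fun _ => K₁.labMap_charts ()
      exists_negative := fun _ => K₁.exists_negative ()
      Glob := K₁.Glob
      gModel := K₁.gModel
      gIso := K₁.gIso
      GLab := K₁.GLab
      gLabMap := K₁.gLabMap
      gLabMap_refl := K₁.gLabMap_refl
      gLabMap_trans := K₁.gLabMap_trans
      toFlStar := K₁.toFlStar
      toFlStar_surjective := K₁.toFlStar_surjective
      gLabT := K₁.gLabT
      gChart₀ := K₁.gChart₀
      gChart₀_mem := K₁.gChart₀_mem
      autCsp_le := K₁.autCsp_le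
      gLab_range := K₁.gLab_range
      atV := fun _ => K₁.atV ()
      phiEll := fun _ => K₁.phiEll ()
      labOfHom := fun _ => K₁.labOfHom ()
      labOfHom_pre := fun _ => K₁.labOfHom_pre ()
      labOfHom_post := fun _ => K₁.labOfHom_post ()
      labOfHom_phiEll_bijective := fun _ => K₁.labOfHom_phiEll_bijective ()
      labOfHom_phiEll_charts := fun _ => K₁.labOfHom_phiEll_charts () }
  exact ⟨K, false, true, Bool.false_ne_true, Ex62.ht K,
    DRepIso.cod_not_surjective (Ex62.ht K) (Ex62.ht K) Bool.false_ne_true⟩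

/-- **IUTchIII:Prop1.3(i)** (kurims p.42) The same witness in FUNCTOR FORM: over a two-place model kit, the strip projection
`DHTRep.codFunctor : †ℋ𝒯^{𝒟-Θ±ell} ↦ †𝔇_≻` of the representative-level groupoid is NOT surjective on the automorphisms of the model
Hodge theater — p417155's `DHTRep.codFunctor_mapIso_not_surjective` is non-vacuous in the tree.
([IUTchIII] Prop 1.3 (i) p.42) [claim: Mochizuki2012, status: disputed] -/
theorem exists_kit_codFunctor_mapIso_not_surjective (l : ℕ) [Fact l.Prime] (hl : l ≠ 2) :
    ∃ (K : PMBaseKit.{0} l) (X : DHTRep K),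
      ¬ Function.Surjective (fun ξ : X ≅ X => DHTRep.codFunctor.mapIso ξ) := by
  obtain ⟨K, v, w, hvw, H, -⟩ := DRepIso.exists_kit_cod_not_surjective l hl
  exact ⟨K, DHTRep.of H, codFunctor_mapIso_not_surjective hvw _ _⟩

end DHTRep

end Literature.IUT.LogThetaLattice
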